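/-
Copyright (c) 2026. Released under the Apache 2.0 license.
-/
import Literature.NumberTheory.EllipticCurves.ManinConstantQuadraticTwistCremonaRangeProofs
import HarnessLib

/-!
# `|c₀(𝒜)| = 1` by twist-descent to a LEVEL-BOUNDED Manin datum — the level bound made GENERIC
# (`B`): the theorems of `ManinConstantQuadraticTwistCremonaRangeProofs.lean` with the fact `h26`
# (Agashe–Ribet–Stein 2006 Thm. 2.6, bound `130000`) replaced by a displayed hypothesis `hB` at
# bound `B`

[Proofs] Theorems only (no definition, no named fact; D-0026). Topic
`Literature/NumberTheory/EllipticCurves`; namespace `Literature.NumberTheory.EllipticCurves.ModularForms`.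

`ManinConstantQuadraticTwistCremonaRangeProofs.lean` (the booked road T-TWIST-CRE) reads the `Γ₀`
twist step `c₀(𝒜) ∣ c(D')` (`maninConstant_dvd_of_charTwist_gamma0`) GLOBALLY against ONE
level-bounded Manin datum: Agashe–Ribet–Stein 2006 Thm. 2.6 (`h26`, Cremona: `c = 1` for every
optimal curve of conductor `≤ 130000`) at the partner class `𝒜'` (`𝒜 = 𝒜' ⊗ χ_{q*}`, `𝒜'` semistable
at the odd `q`). The partner's conductor is `N/q²` (type `I₀*` at `q`) or `N/q` (type `I_ν*`,
`ν ≥ 1`); with the bound `130000` the `I_ν*` key at `q = 3` stops at `N ≤ 390000`.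

This file makes the level bound a PARAMETER `B : ℕ`. Every theorem of the booked file is re-proved
with the SAME proof text, the same inputs and the same citations at the point of use, the fact
`h26` being replaced by the displayed hypothesis
`hB : ∀ W' (globally minimal) D' (X₀(N')-datum with Λ_{E'} ⊆ c·Λ_f), N' ≤ B → |c(D')| = 1`
— the common SHAPE of the tree's level-bounded Manin data
(`AgasheRibetStein2006.cremona_abs_maninConstant_eq_one_of_level_le`, `B = 130000`, PUB;
`cremona_abs_maninConstant_eq_one_of_level_le_300000`, refereed-secondary citing the database
(Česnavičius–Neururer–Saha 2024 §1 / [Cre19]); `cremona_abs_maninConstant_eq_one_of_level_le_400000`,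
Cremona's DETERMINED range, the named input of record (referee A ROUND 325);
`cremona_abs_maninConstant_eq_one_of_level_lt_500000`). The instances live in
`ManinConstantQuadraticTwistCremonaDeterminedRangeProofs.lean`; at `B = 130000` with `hB := h26`
the theorems below are, word for word, the booked ones. Nothing is booked here; tier words are the
referee's.

* `abs_maninConstant_eq_one_of_isTwistOf_conductorNorm_le_bound` — per (class, prime), displayed
  isogenous witness `W ∼ W' ⊗ χ_{q*}` (`W'` globally minimal, `N(W') ∣ N(W)`, `q² ∣ N(W)`,
  `q² ∤ N(W')`, `W` additive at `q`), `N(W') ≤ B` ⟹ `|c| = 1` for every lattice-optimal `X₀`-datum of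
  every globally minimal `W₀ ∼ W`. Binders `hB hnf`.
* `abs_maninConstant_eq_one_of_twistSemistableWitnessAt_of_conductorNorm_le_bound` (`N(W') ≤ B·q`),
  `abs_maninConstant_eq_one_of_quadraticTwist_pStar_of_level_le_bound`,
  `abs_maninConstant_eq_one_of_isSemistableAt_quadraticTwist_pStar_of_level_le_bound`,
  `abs_maninConstant_eq_one_of_kodairaSymbolAt_eq_Istar_zero_of_level_le_bound` (`N ≤ B·q²`),
  `…_Istar_succ_of_level_le_bound`, `…_Istar_of_level_le_bound` (`N ≤ B·q`).
* `classAbsManinConstantEqOne_of_forall_exists_kodairaIstar_or_twist_of_level_le_bound B hB hnf W hcov`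
  — the CLASS certificate; `classAbsManinConstantEqOne_of_forall_exists_kodairaIstar_of_level_le_bound`;
  binder form `not_dvd_maninConstant_of_forall_exists_kodairaIstar_or_twist_of_level_le_bound`.

What this is. A theorem assembled from printed results, printed nowhere as such: the `Γ₀` twisting
formula (Stevens 1989 Lemma (5.4) / Shimura 1971 Prop. 3.64), Stevens 1989 Lemma (5.2) (a tree
THEOREM, `stevens1989_neronLattice_quadraticTwist_oddPrime_holds`), the Néron mapping property,
modularity (`exists_isNewformOf`, to produce the optimal datum of the partner class:
`exists_optimal_modularParametrizationData_of_isNewformOf'` with `latticeEq_of_forall_modularDegree_le`),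
and a level-bounded verification of `c = 1` for optimal curves supplied by the caller (`hB`).
Every input is cited at its use; `q = 2` is not treated (Stevens' `η`).

## References
* [AgasheRibetStein2006] A. Agashe, K. Ribet, W. A. Stein, *The Manin constant*, with an
  appendix by J. Cremona, Pure Appl. Math. Q. 2 (2006) 617–636: Thm. 2.6 (p. 619), appendix §5,
  Thm. 5.2 (p. 633) — the `B = 130000` datum and the method behind every bound.
* [Cremona2022ManinConstants] J. E. Cremona, *Manin constants and optimal curves*, `ecdata/manin.txt`
  (the `B = 400000` / `< 500000` data; `ManinConstantConductorLt500000.lean`).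
* [Stevens1989] G. Stevens, *Stickelberger elements and modular parametrizations of elliptic
  curves*, Invent. Math. 98 (1989) 75–106: Lemma (5.2) p. 96, Lemma (5.4) p. 97.
* [Shimura1971] G. Shimura, *Introduction to the arithmetic theory of automorphic functions*
  (1971), Prop. 3.64.
* [EdixhovenManin1991] B. Edixhoven, Progr. Math. 89 (1991), §1 (typescript L96–101) and Prop. 2.
* [SilvermanATAEC1994] J. H. Silverman, *ATAEC*, IV.10.2, IV.10.4, IV.11.1 (table p. 368), Cor.
  IV.9.1 (Néron mapping property).
* [SilvermanAEC2009] J. H. Silverman, *AEC*, III.4, VII.5 Prop. 5.1, X.2 Ex. 10.16, X.5 Cor. 5.4.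
* [CremonaAlgorithms1997] J. E. Cremona, *Algorithms for Modular Elliptic Curves*, 2nd ed., §3.9
  (twisting commutes with isogenies).
-/

noncomputable section

open scoped MatrixGroups ModularForm Classical

open CongruenceSubgroup WeierstrassCurve IsDedekindDomain IsDedekindDomain.HeightOneSpectrum
  NumberField Rat.HeightOneSpectrum Literature.NumberTheory.Automorphic

namespace Literature.NumberTheory.EllipticCurves.ModularForms

/-! ### Elementary bookkeeping -/

section Elementary

/-- A divisor of `±1` is `±1`. [folklore] -/
private theorem abs_eq_one_of_dvd_of_abs_eq_one {a b : ℤ} (h : a ∣ b) (hb : |b| = 1) : |a| = 1 :=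
  Int.isUnit_iff_abs_eq.mp (isUnit_of_dvd_unit h (Int.isUnit_iff_abs_eq.mpr hb))

/-- If `a ∣ n`, the `q`-adic valuation of `n` exceeds that of `a` by at least `k`, and
`n ≤ B·qᵏ`, then `a ≤ B`. [folklore] -/
private theorem le_of_dvd_of_factorization_le {a n q k B : ℕ} (hq : q.Prime) (ha : a ≠ 0)
    (hn : n ≠ 0) (hdvd : a ∣ n) (hfac : a.factorization q + k ≤ n.factorization q)
    (hlev : n ≤ B * q ^ k) : a ≤ B := by
  obtain ⟨t, rfl⟩ := hdvd
  have ht : t ≠ 0 := fun h ↦ hn (by rw [h, mul_zero])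
  have hk : k ≤ t.factorization q := by
    have h := hfac
    rw [Nat.factorization_mul ha ht, Finsupp.add_apply] at h
    omega
  have hqt : q ^ k ∣ t := (hq.pow_dvd_iff_le_factorization ht).mpr hk
  have hqt' : q ^ k ≤ t := Nat.le_of_dvd (Nat.pos_of_ne_zero ht) hqt
  have h1 : a * q ^ k ≤ B * q ^ k := (Nat.mul_le_mul_left a hqt').trans hlev
  exact le_of_mul_le_mul_right h1 (pow_pos hq.pos k)

variable {q : ℕ}

/-- The place of `ℤ` under `q` has generator `q`. [folklore] -/
private theorem natGenerator_place' (hq : q.Prime) :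
    natGenerator ((primesEquiv (R := ℤ)).symm ⟨q, hq⟩) = q :=
  Literature.NumberTheory.EllipticCurves.Rat.natGenerator_primesEquiv_symm ⟨q, hq⟩

/-- `ord_q(q*) = 1` at the place of `ℤ` under `q`. [folklore] -/
private theorem valuation_pStar' (hq : q.Prime) :
    ((primesEquiv (R := ℤ)).symm ⟨q, hq⟩).valuation ℚ ((((-1 : ℤ) ^ (q / 2) * q : ℤ)) : ℚ) =
      WithZero.exp (-1 : ℤ) := by
  set v : HeightOneSpectrum ℤ := (primesEquiv (R := ℤ)).symm ⟨q, hq⟩ with hv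
  have hgen : natGenerator v = q := natGenerator_place' hq
  have hunit : v.valuation ℚ (((-1 : ℤ) ^ (q / 2) : ℤ) : ℚ) = 1 := by
    rw [Literature.NumberTheory.EllipticCurves.Rat.valuation_intCast_eq_one_iff, hgen]
    intro h
    have hu : IsUnit ((-1 : ℤ) ^ (q / 2)) := (isUnit_neg_one (α := ℤ)).pow _
    have h1 : (q : ℤ) ∣ 1 := h.trans (isUnit_iff_dvd_one.mp hu)
    exact hq.one_lt.ne' (by exact_mod_cast Int.eq_one_of_dvd_one (by positivity) h1)
  have hqv : v.valuation ℚ (q : ℚ) = WithZero.exp (-1 : ℤ) := by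
    rw [← hgen]; exact Rat.HeightOneSpectrum.valuation_natGenerator_int v
  push_cast
  rw [map_mul, hqv]
  have : v.valuation ℚ ((-1 : ℚ) ^ (q / 2)) = 1 := by
    have h := hunit; push_cast at h; exact h
  rw [this, one_mul]

end Elementary

/-! ### The per-(class, prime) theorem with a displayed isogenous witness -/

section Witness

variable {W : WeierstrassCurve ℚ} [W.IsElliptic]
  {W' : WeierstrassCurve ℚ} [W'.IsElliptic] [W'.IsGloballyMinimal]

/-- **`|c₀(𝒜)| = 1` for a class `𝒜` that is the `χ_{q*}`-twist of a class `𝒜'` semistable at the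
odd prime `q` and of conductor `≤ B`, modulo a Manin datum `hB` valid up to level `B`.** Hypotheses: `W ∈ 𝒜` (any model), `W' ∈ 𝒜'`
globally minimal, `W ∼ W'.quadraticTwist q*`; `N(W') ∣ N(W)`, `q² ∣ N(W)`, `q² ∤ N(W')`; `W`
additive at `q`; `N(W') ≤ B`. Conclusion: every lattice-optimal `X₀`-datum `D₀` of every
globally minimal `W₀ ∼ W` has `|D₀.maninConstant| = 1`. Proof: the optimal `X₀`-datum `D'` of `𝒜'`
exists by modularity (`exists_optimal_modularParametrizationData_of_isNewformOf'`, lattice-optimal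
by `latticeEq_of_forall_modularDegree_le`) on a globally minimal `W₁'` with `N(W₁') = N(W')`, hence
semistable at `q`; `aₙ(f_{D₀}) = (n/q)·aₙ(f_{D'})`; Stevens (5.2) (the tree THEOREM
`stevens1989_neronLattice_quadraticTwist_oddPrime_holds`) gives the Néron lattice of the minimal
model of `W₁' ⊗ χ_{q*}`; the twist step `maninConstant_dvd_of_charTwist_gamma0` gives
`D₀.c ∣ D'.c`; and `|D'.c| = 1` by the level-bounded Manin datum `hB` at level `N(W') ≤ B` (at `B = 130000`
this is Agashe–Ribet–Stein 2006 Thm. 2.6 = `h26`, the booked road of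
`ManinConstantQuadraticTwistCremonaRangeProofs.lean`; at `B = 400000` Cremona's DETERMINED range
`h40`, below). Hypotheses consumed by name: `hB`, `hnf` only.
[cite: AgasheRibetStein2006, Thm. 2.6 (p. 619) and appendix Thm. 5.2 (p. 633)]
[cite: Stevens1989, Lemmas (5.2), (5.4)] [cite: EdixhovenManin1991, §1] -/
theorem abs_maninConstant_eq_one_of_isTwistOf_conductorNorm_le_bound
    (B : ℕ)
    (hB : ∀ (V : WeierstrassCurve ℚ) [V.IsElliptic] [V.IsGloballyMinimal] {M : ℕ} [NeZero M]
      (DV : ModularParametrizationData V M),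
      (∀ z ∈ DV.L.lattice, ∃ w ∈ periodLattice DV.f, z = DV.c * w) → M ≤ B →
        |DV.maninConstant| = 1)
    (hnf : exists_isNewformOf)
    {q : ℕ} [Fact q.Prime] (hq2 : q ≠ 2)
    (htw : IsIsogenous W (W'.quadraticTwist (((-1 : ℤ) ^ (q / 2) * q : ℤ) : ℚ)))
    (hN'N : W'.conductorNorm ℤ ∣ W.conductorNorm ℤ) (hqN : q ^ 2 ∣ W.conductorNorm ℤ)
    (hqN' : ¬ q ^ 2 ∣ W'.conductorNorm ℤ)
    (hadd : ¬ W.HasGoodReductionAtPrime q ∧ ¬ W.HasMultiplicativeReductionAtPrime q)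
    (hlev : W'.conductorNorm ℤ ≤ B)
    (W₀ : WeierstrassCurve ℚ) [W₀.IsElliptic] [W₀.IsGloballyMinimal] {N₀ : ℕ} [NeZero N₀]
    (D₀ : ModularParametrizationData W₀ N₀) (hiso : IsIsogenous W W₀)
    (h₀ : ∀ z ∈ D₀.L.lattice, ∃ w ∈ periodLattice D₀.f, z = D₀.c * w) :
    |D₀.maninConstant| = 1 := by
  have hqp : q.Prime := Fact.out
  have hd0 : ((((-1 : ℤ) ^ (q / 2) * q : ℤ)) : ℚ) ≠ 0 := by
    push_cast
    exact mul_ne_zero (pow_ne_zero _ (by norm_num)) (by exact_mod_cast hqp.ne_zero)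
  -- the levels are the conductors
  have hLW₀ : W.LFunction = W₀.LFunction := LFunction_eq_of_isIsogenous_holds W W₀ hiso
  have hnfW : IsNewformOf W D₀.f :=
    ⟨D₀.isNewformOf.1, fun n ↦ by rw [D₀.isNewformOf.2 n, hLW₀]⟩
  have hN₀ : N₀ = W.conductorNorm ℤ :=
    IsNewformOf.level_eq_conductorNorm_of_exists_isNewformOf hnf hnfW
  haveI : NeZero (W'.conductorNorm ℤ) := ⟨(conductorNorm_pos_holds W').ne'⟩
  -- the optimal `X₀`-datum `D'` of `𝒜'`, on a globally minimal `W₁' ∼ W'`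
  obtain ⟨f', hf'⟩ := hnf W'
  obtain ⟨W₁', hE₁', hM₁', D', hD'f, -, hmin⟩ :=
    exists_optimal_modularParametrizationData_of_isNewformOf' (W'.conductorNorm ℤ) W' rfl hf'
  haveI := hE₁'
  haveI := hM₁'
  have hopt' : ∀ z ∈ D'.L.lattice, ∃ w ∈ periodLattice D'.f, z = D'.c * w :=
    D'.latticeEq_of_forall_modularDegree_le fun W₂ _ D₂ h2 ↦ hmin W₂ D₂ (h2.trans hD'f)
  -- `W₁'` is semistable at `q`: its conductor is the level `N(W')`, and `q² ∤ N(W')`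
  have hN'₁ : W'.conductorNorm ℤ = W₁'.conductorNorm ℤ :=
    IsNewformOf.level_eq_conductorNorm_of_exists_isNewformOf hnf D'.isNewformOf
  have hsemi : W₁'.HasGoodReductionAtPrime q ∨ W₁'.HasMultiplicativeReductionAtPrime q :=
    hasGoodReductionAtPrime_or_hasMultiplicativeReductionAtPrime_of_not_sq_dvd_conductorNorm
      (by rw [← hN'₁]; exact hqN')
  -- the minimal model `C` of `W₁' ⊗ χ_{q*}` and a Néron pair of it
  haveI : (W₁'.quadraticTwist (((-1 : ℤ) ^ (q / 2) * q : ℤ) : ℚ)).IsElliptic :=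
    W₁'.isElliptic_quadraticTwist hd0
  obtain ⟨vC, hvC⟩ := hasGlobalMinimalModel_rat_holds
    (W₁'.quadraticTwist (((-1 : ℤ) ^ (q / 2) * q : ℤ) : ℚ))
  haveI := hvC
  haveI : ((vC • W₁'.quadraticTwist (((-1 : ℤ) ^ (q / 2) * q : ℤ) : ℚ)).baseChange ℂ).IsElliptic := by
    rw [WeierstrassCurve.baseChange]; infer_instance
  obtain ⟨LC, hC⟩ := exists_isNeronLatticeOf_holds
    ((vC • W₁'.quadraticTwist (((-1 : ℤ) ^ (q / 2) * q : ℤ) : ℚ)).baseChange ℂ)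
  -- the Legendre character and Gauss's evaluation
  have hχq := isQuadratic_quadraticChar_ringHomComp q
  have hχp := isPrimitive_quadraticChar_ringHomComp q hq2
  have hG := gaussSum_quadraticChar_ringHomComp_sq q hq2
  -- the newform of `𝒜` is the `(·/q)`-twist of that of `𝒜'`
  have hLtw : W.LFunction =
      (W'.quadraticTwist (((-1 : ℤ) ^ (q / 2) * q : ℤ) : ℚ)).LFunction := by
    haveI : (W'.quadraticTwist (((-1 : ℤ) ^ (q / 2) * q : ℤ) : ℚ)).IsElliptic :=
      W'.isElliptic_quadraticTwist hd0
    exact LFunction_eq_of_isIsogenous_holds _ _ htw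
  have hf : ∀ n : ℕ, cuspCoeff D₀.f n =
      (quadraticChar (ZMod q)).ringHomComp (Int.castRingHom ℂ) n * cuspCoeff D'.f n := by
    intro n
    have hLn : W₀.LFunction n = W.LFunction n := by rw [hLW₀]
    rw [D₀.isNewformOf.2 n, hD'f, hf'.2 n, hLn, quadraticChar_ringHomComp_apply_natCast q n]
    by_cases hqn : q ∣ n
    · have h0 : W.LFunction n = 0 :=
        W.LFunction_apply_eq_zero_of_not_good_of_not_mult q hadd.1 hadd.2 hqn
      have hl : legendreSym q n = 0 := (legendreSym.eq_zero_iff q n).mpr (by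
        rw [ZMod.intCast_zmod_eq_zero_iff_dvd]
        exact_mod_cast hqn)
      rw [h0, hl]
      simp
    · have hLn' : W.LFunction n =
          (W'.quadraticTwist (((-1 : ℤ) ^ (q / 2) * q : ℤ) : ℚ)).LFunction n := by rw [hLtw]
      rw [hLn', W'.LFunction_quadraticTwist_pStar_apply hq2 hqn]
      have hne : ((n : ℤ) : ZMod q) ≠ 0 := by
        rw [Int.cast_natCast, Ne, ZMod.natCast_eq_zero_iff]
        exact hqn
      push_cast
      rcases legendreSym.eq_one_or_neg_one q hne with h1 | h1
      · rw [show (legendreSym q (n : ℤ)) = legendreSym q n from rfl, h1]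
      · rw [show (legendreSym q (n : ℤ)) = legendreSym q n from rfl, h1]
  -- conductor bookkeeping at level `N₀ = N(W)`
  have hN : W'.conductorNorm ℤ ∣ N₀ := by rw [hN₀]; exact hN'N
  have hm : q ^ 2 ∣ N₀ := by rw [hN₀]; exact hqN
  -- Stevens (5.2), PROVED: the Néron lattice of `C` is `g(χ)⁻¹ Λ(D')`
  have hLC : ∀ z : ℂ, z ∈ LC.lattice ↔
      gaussSum ((quadraticChar (ZMod q)).ringHomComp (Int.castRingHom ℂ))
        (ZMod.stdAddChar (N := q)) * z ∈ D'.L.lattice :=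
    stevens1989_neronLattice_quadraticTwist_oddPrime_holds W₁' D'.L D'.isNeronLattice q hq2 hsemi
      (vC • W₁'.quadraticTwist (((-1 : ℤ) ^ (q / 2) * q : ℤ) : ℚ)) ⟨vC, rfl⟩ LC hC _ hG
  -- the twist step on `Γ₀`: `c(D₀) ∣ c(D')`
  have hdvd : D₀.c ∣ D'.c :=
    maninConstant_dvd_of_charTwist_gamma0 D' D₀ h₀ hχq hχp hN hm hf hC hLC
  -- the level-bounded Manin datum at the partner's level `N(W') ≤ B`
  have h1 : |D'.maninConstant| = 1 := hB W₁' D' hopt' hlev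
  exact abs_eq_one_of_dvd_of_abs_eq_one hdvd h1

/-- The binder form of `abs_maninConstant_eq_one_of_isTwistOf_conductorNorm_le_bound`: under the same
hypotheses, `p ∤ D₀.maninConstant` for EVERY prime `p`.
[cite: AgasheRibetStein2006, Thm. 2.6] [cite: Stevens1989, Lemmas (5.2), (5.4)] -/
theorem not_dvd_maninConstant_of_isTwistOf_conductorNorm_le_bound
    (B : ℕ)
    (hB : ∀ (V : WeierstrassCurve ℚ) [V.IsElliptic] [V.IsGloballyMinimal] {M : ℕ} [NeZero M]
      (DV : ModularParametrizationData V M),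
      (∀ z ∈ DV.L.lattice, ∃ w ∈ periodLattice DV.f, z = DV.c * w) → M ≤ B →
        |DV.maninConstant| = 1)
    (hnf : exists_isNewformOf)
    {q : ℕ} [Fact q.Prime] (hq2 : q ≠ 2)
    (htw : IsIsogenous W (W'.quadraticTwist (((-1 : ℤ) ^ (q / 2) * q : ℤ) : ℚ)))
    (hN'N : W'.conductorNorm ℤ ∣ W.conductorNorm ℤ) (hqN : q ^ 2 ∣ W.conductorNorm ℤ)
    (hqN' : ¬ q ^ 2 ∣ W'.conductorNorm ℤ)
    (hadd : ¬ W.HasGoodReductionAtPrime q ∧ ¬ W.HasMultiplicativeReductionAtPrime q)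
    (hlev : W'.conductorNorm ℤ ≤ B)
    (W₀ : WeierstrassCurve ℚ) [W₀.IsElliptic] [W₀.IsGloballyMinimal] {N₀ : ℕ} [NeZero N₀]
    (D₀ : ModularParametrizationData W₀ N₀) (hiso : IsIsogenous W W₀)
    (h₀ : ∀ z ∈ D₀.L.lattice, ∃ w ∈ periodLattice D₀.f, z = D₀.c * w)
    {p : ℕ} (hp : p.Prime) : ¬ (p : ℤ) ∣ D₀.maninConstant := by
  intro hpdvd
  have h1 : |D₀.maninConstant| = 1 :=
    abs_maninConstant_eq_one_of_isTwistOf_conductorNorm_le_bound B hB hnf hq2 htw hN'N hqN hqN' hadd hlev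
      W₀ D₀ hiso h₀
  have h2 : (p : ℤ) ∣ 1 := h1 ▸ (dvd_abs _ _).mpr hpdvd
  have h3 : (p : ℤ) = 1 := Int.eq_one_of_dvd_one (by positivity) h2
  exact hp.one_lt.ne' (by exact_mod_cast h3)

end Witness

/-! ### From the tree's displayed witness `TwistSemistableWitnessAt` -/

section DisplayedWitness

/-- **From the displayed witness of `ManinConstantClassCertificateTwist.lean`**:
`TwistSemistableWitnessAt W' q` (a globally minimal `V` semistable at the odd `q` with
`W' ∼ V ⊗ χ_{q*}`, `N(V) ∣ N(W')`, `N(V)·q ∣ N(W')`, `W'` additive at `q`; the torsion clause is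
NOT used) together with `N(W') ≤ B·q` (so `N(V) ≤ N(W')/q ≤ B`) gives `|c| = 1` for
every lattice-optimal `X₀`-datum of the globally minimal `W'` — all primes at once, binders
`B hB hnf`. [cite: AgasheRibetStein2006, Thm. 2.6] [cite: Stevens1989, Lemmas (5.2), (5.4)]
[cite: EdixhovenManin1991, §1] -/
theorem abs_maninConstant_eq_one_of_twistSemistableWitnessAt_of_conductorNorm_le_bound
    (B : ℕ)
    (hB : ∀ (V : WeierstrassCurve ℚ) [V.IsElliptic] [V.IsGloballyMinimal] {M : ℕ} [NeZero M]
      (DV : ModularParametrizationData V M),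
      (∀ z ∈ DV.L.lattice, ∃ w ∈ periodLattice DV.f, z = DV.c * w) → M ≤ B →
        |DV.maninConstant| = 1)
    (hnf : exists_isNewformOf)
    (W' : WeierstrassCurve ℚ) [W'.IsElliptic] [W'.IsGloballyMinimal] {N' : ℕ} [NeZero N']
    (D' : ModularParametrizationData W' N')
    (hopt : ∀ z ∈ D'.L.lattice, ∃ w ∈ periodLattice D'.f, z = D'.c * w)
    {q : ℕ} [Fact q.Prime] (htw : TwistSemistableWitnessAt W' q)
    (hlev : W'.conductorNorm ℤ ≤ B * q) : |D'.maninConstant| = 1 := by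
  have hqp : q.Prime := Fact.out
  obtain ⟨hq2, V, hVE, hVM, hiso, hdvd, hdvdq, hsq, hadd, -⟩ := htw
  haveI := hVE
  haveI := hVM
  have hlevV : V.conductorNorm ℤ ≤ B := by
    have h1 : V.conductorNorm ℤ * q ≤ W'.conductorNorm ℤ :=
      Nat.le_of_dvd (conductorNorm_pos_holds W') hdvdq
    exact le_of_mul_le_mul_right (h1.trans hlev) hqp.pos
  exact abs_maninConstant_eq_one_of_isTwistOf_conductorNorm_le_bound B hB hnf hq2 hiso hdvd
    (sq_dvd_conductorNorm_of_not_good_of_not_mult hadd) hsq hadd hlevV W' D'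
    (IsIsogenous.refl_holds W') hopt

end DisplayedWitness

/-! ### No witness: the twist of `W` itself is semistable at `q` -/

section Semistable

variable {W : WeierstrassCurve ℚ} [W.IsElliptic] [W.IsGloballyMinimal] {N : ℕ} [NeZero N]

/-- **`|c₀| = 1` when the optimal curve is the `q*`-twist of a curve semistable at the odd prime
`q` whose conductor is `≤ B` (generic bound).** Modulo the level-`B` Manin datum `hB` and
modularity (`hnf`): for a globally minimal `W` with a lattice-optimal `X₀(N)`-datum `D`, an odd
prime `q` with `q² ∣ N`, such that the twist `Q = W.quadraticTwist q*` has good reduction at the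
place of `q` and `N ≤ B·q²`, or multiplicative reduction there and `N ≤ B·q`:
`|D.c| = 1`. Inside (as in `not_dvd_maninConstant_of_isSemistableAt_quadraticTwist_pStar`): the
global minimal model `A` of `Q` (`hasGlobalMinimalModel_rat_holds`) is semistable at `q`, so
`f_q(A) ≤ 1 < 2 ≤ f_q(W)` and `f_ℓ(A) = f_ℓ(W)` at `ℓ ≠ q` (`conductorExponent_twistModel`), whence
`N(A) ∣ N`, `N(A)·q ∣ N` (`N(A)·q² ∣ N` if `A` is good at `q`) and `N(A) ≤ B`;
`W ≅ W^{(q*·q*)} = Q^{(q*)} ∼ A^{(q*)}` (`exists_variableChange_quadraticTwist_one`,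
`exists_variableChange_quadraticTwist_mul_sq`, `quadraticTwist_quadraticTwist`,
`IsIsogenous.quadraticTwist`); then `abs_maninConstant_eq_one_of_isTwistOf_conductorNorm_le_bound`
with `W' := A`. [cite: AgasheRibetStein2006, Thm. 2.6] [cite: Stevens1989, Lemmas (5.2), (5.4)]
[cite: SilvermanATAEC1994, IV.10.2 and IV.10.4] [cite: CremonaAlgorithms1997, §3.9] -/
theorem abs_maninConstant_eq_one_of_quadraticTwist_pStar_of_level_le_bound
    (B : ℕ)
    (hB : ∀ (V : WeierstrassCurve ℚ) [V.IsElliptic] [V.IsGloballyMinimal] {M : ℕ} [NeZero M]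
      (DV : ModularParametrizationData V M),
      (∀ z ∈ DV.L.lattice, ∃ w ∈ periodLattice DV.f, z = DV.c * w) → M ≤ B →
        |DV.maninConstant| = 1)
    (hnf : exists_isNewformOf)
    (D : ModularParametrizationData W N)
    (hopt : ∀ z ∈ D.L.lattice, ∃ w ∈ periodLattice D.f, z = D.c * w)
    {q : ℕ} (hq : q.Prime) (hq2 : q ≠ 2) (hsq : q ^ 2 ∣ N)
    (hbound :
      ((W.quadraticTwist (((-1 : ℤ) ^ (q / 2) * q : ℤ) : ℚ)).HasGoodReductionAt
          ((primesEquiv (R := ℤ)).symm ⟨q, hq⟩) ∧ N ≤ B * q ^ 2) ∨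
      ((W.quadraticTwist (((-1 : ℤ) ^ (q / 2) * q : ℤ) : ℚ)).HasMultiplicativeReductionAt
          ((primesEquiv (R := ℤ)).symm ⟨q, hq⟩) ∧ N ≤ B * q)) :
    |D.maninConstant| = 1 := by
  haveI := Fact.mk hq
  set d : ℤ := (-1 : ℤ) ^ (q / 2) * q with hd
  set k : ℤ := (d - 1) / 4 with hk
  have h4k : (4 : ℤ) * k + 1 = d := by
    have h4 := four_dvd_pStar_sub_one (p := q) hq2
    have := Int.ediv_mul_cancel h4
    rw [hk]; linarith [this]
  have h4kℚ : (4 : ℚ) * (k : ℚ) + 1 = (d : ℚ) := by exact_mod_cast h4k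
  have hdZ : d ≠ 0 := mul_ne_zero (pow_ne_zero _ (by norm_num)) (by exact_mod_cast hq.ne_zero)
  have hd0 : (d : ℚ) ≠ 0 := by exact_mod_cast hdZ
  set vq : HeightOneSpectrum ℤ := (primesEquiv (R := ℤ)).symm ⟨q, hq⟩ with hvq
  -- the level is the conductor
  have hN : N = W.conductorNorm ℤ :=
    IsNewformOf.level_eq_conductorNorm_of_exists_isNewformOf hnf D.isNewformOf
  have hN0 : N ≠ 0 := NeZero.ne N
  -- `f_q(W) ≥ 2`: `W` is additive at `q`
  have hfW : 2 ≤ W.conductorExponent vq := by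
    rw [← factorization_conductorNorm_primesEquiv_symm W ⟨q, hq⟩, ← hN]
    exact (hq.pow_dvd_iff_le_factorization hN0).mp hsq
  have hadd : ¬ W.HasGoodReductionAtPrime q ∧ ¬ W.HasMultiplicativeReductionAtPrime q := by
    refine ⟨fun hg ↦ ?_, fun hmu ↦ ?_⟩
    · have h0 : W.conductorExponent vq = 0 := (conductorExponent_eq_zero_iff_holds vq W).mpr
        ((W.hasGoodReductionAtPrime_iff_hasGoodReductionAt_holds ⟨q, hq⟩).mp hg)
      omega
    · have h1 : W.conductorExponent vq = 1 := (conductorExponent_eq_one_iff_holds vq W).mpr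
        ((W.hasMultiplicativeReductionAtPrime_iff_hasMultiplicativeReductionAt_holds ⟨q, hq⟩).mp hmu)
      omega
  -- the twist `Q` and its global minimal model `A`
  set Q : WeierstrassCurve ℚ := W.quadraticTwist (d : ℚ) with hQ
  haveI hQell : Q.IsElliptic := W.isElliptic_quadraticTwist hd0
  obtain ⟨CA, hA⟩ := hasGlobalMinimalModel_rat_holds Q
  set A : WeierstrassCurve ℚ := CA • Q with hAdef
  haveI : A.IsGloballyMinimal := hA
  have hNA0 : A.conductorNorm ℤ ≠ 0 := (conductorNorm_pos_holds A).ne'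
  -- `A` is semistable at `q`, with the level bound attached to its case
  have hsemiA : (A.HasGoodReductionAt vq ∧ N ≤ B * q ^ 2) ∨
      (A.HasMultiplicativeReductionAt vq ∧ N ≤ B * q) := by
    rcases hbound with ⟨hg, hl⟩ | ⟨hm, hl⟩
    · exact Or.inl ⟨(hasGoodReductionAt_smul_iff_holds vq Q CA).mpr hg, hl⟩
    · exact Or.inr ⟨(hasMultiplicativeReductionAt_smul_iff_holds vq Q CA).mpr hm, hl⟩
  have hfA : A.conductorExponent vq ≤ 1 := by
    rcases hsemiA with ⟨hg, -⟩ | ⟨hm, -⟩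
    · rw [(conductorExponent_eq_zero_iff_holds vq A).mpr hg]; exact Nat.zero_le 1
    · rw [(conductorExponent_eq_one_iff_holds vq A).mpr hm]
  -- `q² ∤ N(A)`
  have hqNA : ¬ q ^ 2 ∣ A.conductorNorm ℤ := by
    rw [hq.pow_dvd_iff_le_factorization hNA0, factorization_conductorNorm_primesEquiv_symm A ⟨q, hq⟩,
      ← hvq]
    exact not_le.mpr (lt_of_le_of_lt hfA one_lt_two)
  -- `N(A) ∣ N`, prime by prime
  have hNA : A.conductorNorm ℤ ∣ N := by
    refine conductorNorm_dvd_of_forall_conductorExponent_le A hN0 fun p ↦ ?_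
    rw [hN, factorization_conductorNorm_primesEquiv_symm W p]
    by_cases hpq : (p : ℕ) = q
    · have hp' : p = ⟨q, hq⟩ := Subtype.ext hpq
      rw [hp', ← hvq]
      exact hfA.trans ((Nat.le_succ 1).trans hfW)
    · -- unramified place: `f_p(A) = f_p(Q) = f_p(W.twistModel k) = f_p(W)`
      set v : HeightOneSpectrum ℤ := (primesEquiv (R := ℤ)).symm p with hv
      have hgenp : natGenerator v = p :=
        Literature.NumberTheory.EllipticCurves.Rat.natGenerator_primesEquiv_symm p
      obtain ⟨C₀, -, hC₀⟩ := exists_variableChange_twistModel_eq_quadraticTwist W (k : ℚ)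
      rw [h4kℚ] at hC₀
      haveI hTell : (W.twistModel (k : ℚ)).IsElliptic := by
        have h : W.twistModel (k : ℚ) = C₀⁻¹ • Q := by
          rw [hQ, ← hC₀, ← mul_smul, inv_mul_cancel, one_smul]
        rw [h]; infer_instance
      have hkv : v.valuation ℚ (k : ℚ) ≤ 1 := by
        rw [show (k : ℚ) = algebraMap ℤ ℚ k from (eq_intCast _ k).symm]
        exact HeightOneSpectrum.valuation_le_one v k
      have hdv : v.valuation ℚ (4 * (k : ℚ) + 1) = 1 := by
        rw [h4kℚ, Literature.NumberTheory.EllipticCurves.Rat.valuation_intCast_eq_one_iff, hgenp]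
        intro h
        have hu : IsUnit ((-1 : ℤ) ^ (q / 2)) := (isUnit_neg_one (α := ℤ)).pow _
        have h' : ((p : ℕ) : ℤ) ∣ (q : ℤ) := (hu.dvd_mul_left).mp h
        exact hpq ((Nat.prime_dvd_prime_iff_eq p.2 hq).mp (Int.natCast_dvd_natCast.mp h'))
      have h1 : A.conductorExponent v = Q.conductorExponent v := conductorExponent_smul' v Q CA
      have h2 : Q.conductorExponent v = (W.twistModel (k : ℚ)).conductorExponent v := by
        rw [hQ, ← hC₀, conductorExponent_smul']
      have h3 : (W.twistModel (k : ℚ)).conductorExponent v = W.conductorExponent v :=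
        conductorExponent_twistModel v W hkv hdv
      rw [h1, h2, h3]
  -- the level bound of the partner: `N(A) ≤ B`
  have hlevA : A.conductorNorm ℤ ≤ B := by
    have hfacA : (A.conductorNorm ℤ).factorization q = A.conductorExponent vq := by
      rw [factorization_conductorNorm_primesEquiv_symm A ⟨q, hq⟩, ← hvq]
    have hfacN : N.factorization q = W.conductorExponent vq := by
      rw [hN, factorization_conductorNorm_primesEquiv_symm W ⟨q, hq⟩, ← hvq]
    rcases hsemiA with ⟨hg, hl⟩ | ⟨hm, hl⟩
    · have h0 : A.conductorExponent vq = 0 := (conductorExponent_eq_zero_iff_holds vq A).mpr hg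
      refine le_of_dvd_of_factorization_le (k := 2) hq hNA0 hN0 hNA ?_ hl
      rw [hfacA, hfacN, h0]; omega
    · have h1 : A.conductorExponent vq = 1 :=
        (conductorExponent_eq_one_iff_holds vq A).mpr hm
      refine le_of_dvd_of_factorization_le (k := 1) hq hNA0 hN0 hNA ?_ (by simpa using hl)
      rw [hfacA, hfacN, h1]; omega
  -- `W ∼ A ⊗ χ_{q*}`: `W ≅ W^{(1)} ≅ W^{(d·d)} = Q^{(d)} ∼ A^{(d)}`
  have htw : IsIsogenous W (A.quadraticTwist (d : ℚ)) := by
    obtain ⟨C₁, hC₁⟩ := W.exists_variableChange_quadraticTwist_one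
    obtain ⟨C₂, hC₂⟩ := W.exists_variableChange_quadraticTwist_mul_sq (1 : ℚ) (d : ℚ) hd0
    have h12 : IsIsogenous W (W.quadraticTwist ((1 : ℚ) * (d : ℚ) ^ 2)) :=
      IsIsogenous.trans' (isIsogenous_of_smul_eq hC₁) (isIsogenous_of_smul_eq hC₂)
    have hdd : W.quadraticTwist ((1 : ℚ) * (d : ℚ) ^ 2) = Q.quadraticTwist (d : ℚ) := by
      rw [hQ, quadraticTwist_quadraticTwist]; congr 1; ring
    rw [hdd] at h12
    exact IsIsogenous.trans' h12 ((isIsogenous_smul Q CA).quadraticTwist hd0)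
  -- conductor bookkeeping on `W`
  have hNA' : A.conductorNorm ℤ ∣ W.conductorNorm ℤ := hN ▸ hNA
  have hqN : q ^ 2 ∣ W.conductorNorm ℤ := hN ▸ hsq
  exact abs_maninConstant_eq_one_of_isTwistOf_conductorNorm_le_bound B hB hnf hq2 htw hNA' hqN hqNA hadd
    hlevA W D (IsIsogenous.refl_holds W) hopt

/-- **`|c₀| = 1` when `W ⊗ χ_{q*}` is good or multiplicative at the odd prime `q`, `q² ∣ N`, and
`N ≤ B·q`** (the uniform level bound; `N ≤ B·q ≤ B·q²` serves the good case too).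
Modulo `B hB hnf`. [cite: AgasheRibetStein2006, Thm. 2.6] [cite: Stevens1989, Lemmas (5.2), (5.4)] -/
theorem abs_maninConstant_eq_one_of_isSemistableAt_quadraticTwist_pStar_of_level_le_bound
    (B : ℕ)
    (hB : ∀ (V : WeierstrassCurve ℚ) [V.IsElliptic] [V.IsGloballyMinimal] {M : ℕ} [NeZero M]
      (DV : ModularParametrizationData V M),
      (∀ z ∈ DV.L.lattice, ∃ w ∈ periodLattice DV.f, z = DV.c * w) → M ≤ B →
        |DV.maninConstant| = 1)
    (hnf : exists_isNewformOf)
    (D : ModularParametrizationData W N)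
    (hopt : ∀ z ∈ D.L.lattice, ∃ w ∈ periodLattice D.f, z = D.c * w)
    {q : ℕ} (hq : q.Prime) (hq2 : q ≠ 2) (hsq : q ^ 2 ∣ N)
    (hsemi : (W.quadraticTwist (((-1 : ℤ) ^ (q / 2) * q : ℤ) : ℚ)).HasGoodReductionAt
        ((primesEquiv (R := ℤ)).symm ⟨q, hq⟩) ∨
      (W.quadraticTwist (((-1 : ℤ) ^ (q / 2) * q : ℤ) : ℚ)).HasMultiplicativeReductionAt
        ((primesEquiv (R := ℤ)).symm ⟨q, hq⟩))
    (hlev : N ≤ B * q) : |D.maninConstant| = 1 := by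
  refine abs_maninConstant_eq_one_of_quadraticTwist_pStar_of_level_le_bound B hB hnf D hopt hq hq2 hsq ?_
  rcases hsemi with hg | hm
  · refine Or.inl ⟨hg, hlev.trans ?_⟩
    have : q ≤ q ^ 2 := by rw [pow_two]; exact Nat.le_mul_of_pos_left q hq.pos
    exact Nat.mul_le_mul_left B this
  · exact Or.inr ⟨hm, hlev⟩

end Semistable

/-! ### Kodaira-keyed front-ends: type `Iₙ*` at an odd prime, with the level bound -/

section Istar

variable {W : WeierstrassCurve ℚ} [W.IsElliptic] [W.IsGloballyMinimal] {N : ℕ} [NeZero N]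

/-- **Kodaira type `I₀*` at an odd prime `q` and `N ≤ B·q²` ⟹ `|c₀| = 1`.** Modulo
`B hB hnf`: the `q*`-twist of `W` has GOOD reduction at `q`
(`hasGoodReductionAt_quadraticTwist_of_kodairaSymbolAt_eq_Istar_zero`, Silverman *ATAEC* IV.11.1
table p. 368), `f_q(W) = 2` so `q² ∣ N` (`conductorExponent_eq_two_of_kodairaSymbolAt`), and the
partner's conductor `N/q²` is `≤ B`; then
`abs_maninConstant_eq_one_of_quadraticTwist_pStar_of_level_le_bound`.  [cite: AgasheRibetStein2006, Thm. 2.6]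
[cite: SilvermanATAEC1994, IV.11.1 table p. 368 (I₀*)] [cite: Stevens1989, Lemmas (5.2), (5.4)] -/
theorem abs_maninConstant_eq_one_of_kodairaSymbolAt_eq_Istar_zero_of_level_le_bound
    (B : ℕ)
    (hB : ∀ (V : WeierstrassCurve ℚ) [V.IsElliptic] [V.IsGloballyMinimal] {M : ℕ} [NeZero M]
      (DV : ModularParametrizationData V M),
      (∀ z ∈ DV.L.lattice, ∃ w ∈ periodLattice DV.f, z = DV.c * w) → M ≤ B →
        |DV.maninConstant| = 1)
    (hnf : exists_isNewformOf)
    (D : ModularParametrizationData W N)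
    (hopt : ∀ z ∈ D.L.lattice, ∃ w ∈ periodLattice D.f, z = D.c * w)
    {q : ℕ} (hq : q.Prime) (hq2 : q ≠ 2)
    (hK : W.kodairaSymbolAt ((primesEquiv (R := ℤ)).symm ⟨q, hq⟩) = .Istar 0)
    (hlev : N ≤ B * q ^ 2) : |D.maninConstant| = 1 := by
  haveI := Fact.mk hq
  set vq : HeightOneSpectrum ℤ := (primesEquiv (R := ℤ)).symm ⟨q, hq⟩ with hvq
  have hgen : natGenerator vq = q := natGenerator_place' hq
  have h2 : ringChar (ℤ ⧸ vq.asIdeal) ≠ 2 := by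
    rw [Rat.ringChar_int_quotient_asIdeal, hgen]; exact hq2
  have hgood := W.hasGoodReductionAt_quadraticTwist_of_kodairaSymbolAt_eq_Istar_zero vq h2 hK
    (valuation_pStar' hq)
  have hN : N = W.conductorNorm ℤ :=
    IsNewformOf.level_eq_conductorNorm_of_exists_isNewformOf hnf D.isNewformOf
  have hf2 : W.conductorExponent vq = 2 :=
    W.conductorExponent_eq_two_of_kodairaSymbolAt vq h2 (Or.inr (Or.inr ⟨0, hK⟩))
  have hsq : q ^ 2 ∣ N := by
    rw [hN, hq.pow_dvd_iff_le_factorization (conductorNorm_pos_holds W).ne',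
      factorization_conductorNorm_primesEquiv_symm W ⟨q, hq⟩, ← hvq, hf2]
  exact abs_maninConstant_eq_one_of_quadraticTwist_pStar_of_level_le_bound B hB hnf D hopt hq hq2 hsq
    (Or.inl ⟨hgood, hlev⟩)

/-- **Kodaira type `I_ν*`, `ν ≥ 1`, at an odd prime `q` and `N ≤ B·q` ⟹ `|c₀| = 1`.** Modulo
`B hB hnf`: the `q*`-twist of `W` is MULTIPLICATIVE at `q`
(`hasMultiplicativeReductionAt_quadraticTwist_pStar_of_kodairaSymbolAt_eq_Istar_succ`), `f_q(W) = 2`,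
and the partner's conductor `N/q` is `≤ B`. At `B = 400000` the bound `N ≤ 400000·q` holds for every
`N ≤ 500000` at every odd `q` — in particular at `q = 3`, where `B = 130000` stopped at `N ≤ 390000`. [cite: AgasheRibetStein2006, Thm. 2.6]
[cite: SilvermanATAEC1994, IV.11.1 table p. 368 (I_ν*)] [cite: Stevens1989, Lemmas (5.2), (5.4)] -/
theorem abs_maninConstant_eq_one_of_kodairaSymbolAt_eq_Istar_succ_of_level_le_bound
    (B : ℕ)
    (hB : ∀ (V : WeierstrassCurve ℚ) [V.IsElliptic] [V.IsGloballyMinimal] {M : ℕ} [NeZero M]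
      (DV : ModularParametrizationData V M),
      (∀ z ∈ DV.L.lattice, ∃ w ∈ periodLattice DV.f, z = DV.c * w) → M ≤ B →
        |DV.maninConstant| = 1)
    (hnf : exists_isNewformOf)
    (D : ModularParametrizationData W N)
    (hopt : ∀ z ∈ D.L.lattice, ∃ w ∈ periodLattice D.f, z = D.c * w)
    {q : ℕ} (hq : q.Prime) (hq2 : q ≠ 2) {n : ℕ}
    (hK : W.kodairaSymbolAt ((primesEquiv (R := ℤ)).symm ⟨q, hq⟩) = .Istar (n + 1))
    (hlev : N ≤ B * q) : |D.maninConstant| = 1 := by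
  set vq : HeightOneSpectrum ℤ := (primesEquiv (R := ℤ)).symm ⟨q, hq⟩ with hvq
  have hgen : natGenerator vq = q := natGenerator_place' hq
  have h2 : ringChar (ℤ ⧸ vq.asIdeal) ≠ 2 := by
    rw [Rat.ringChar_int_quotient_asIdeal, hgen]; exact hq2
  have hmult := hasMultiplicativeReductionAt_quadraticTwist_pStar_of_kodairaSymbolAt_eq_Istar_succ
    (W := W) hq hq2 hK
  have hN : N = W.conductorNorm ℤ :=
    IsNewformOf.level_eq_conductorNorm_of_exists_isNewformOf hnf D.isNewformOf
  have hf2 : W.conductorExponent vq = 2 :=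
    W.conductorExponent_eq_two_of_kodairaSymbolAt vq h2 (Or.inr (Or.inr ⟨n + 1, hK⟩))
  have hsq : q ^ 2 ∣ N := by
    rw [hN, hq.pow_dvd_iff_le_factorization (conductorNorm_pos_holds W).ne',
      factorization_conductorNorm_primesEquiv_symm W ⟨q, hq⟩, ← hvq, hf2]
  exact abs_maninConstant_eq_one_of_quadraticTwist_pStar_of_level_le_bound B hB hnf D hopt hq hq2 hsq
    (Or.inr ⟨hmult, hlev⟩)

/-- **Kodaira type `Iₙ*` (any `n ≥ 0`) at an odd prime `q` and `N ≤ B·q` ⟹ `|c₀| = 1`** —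
the union of the two previous theorems (`B·q ≤ B·q²`). Modulo `B hB hnf`.
[cite: AgasheRibetStein2006, Thm. 2.6] [cite: SilvermanATAEC1994, IV.11.1 table p. 368] -/
theorem abs_maninConstant_eq_one_of_kodairaSymbolAt_eq_Istar_of_level_le_bound
    (B : ℕ)
    (hB : ∀ (V : WeierstrassCurve ℚ) [V.IsElliptic] [V.IsGloballyMinimal] {M : ℕ} [NeZero M]
      (DV : ModularParametrizationData V M),
      (∀ z ∈ DV.L.lattice, ∃ w ∈ periodLattice DV.f, z = DV.c * w) → M ≤ B →
        |DV.maninConstant| = 1)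
    (hnf : exists_isNewformOf)
    (D : ModularParametrizationData W N)
    (hopt : ∀ z ∈ D.L.lattice, ∃ w ∈ periodLattice D.f, z = D.c * w)
    {q : ℕ} (hq : q.Prime) (hq2 : q ≠ 2) {n : ℕ}
    (hK : W.kodairaSymbolAt ((primesEquiv (R := ℤ)).symm ⟨q, hq⟩) = .Istar n)
    (hlev : N ≤ B * q) : |D.maninConstant| = 1 := by
  cases n with
  | zero =>
    refine abs_maninConstant_eq_one_of_kodairaSymbolAt_eq_Istar_zero_of_level_le_bound B hB hnf D hopt hq
      hq2 hK (hlev.trans ?_)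
    have : q ≤ q ^ 2 := by rw [pow_two]; exact Nat.le_mul_of_pos_left q hq.pos
    exact Nat.mul_le_mul_left B this
  | succ n =>
    exact abs_maninConstant_eq_one_of_kodairaSymbolAt_eq_Istar_succ_of_level_le_bound B hB hnf D hopt hq
      hq2 hK hlev

end Istar

/-! ### The class certificate: ONE odd prime of type `Iₙ*` (or a displayed witness) with the level bound -/

/-- **`ClassAbsManinConstantEqOne W` by twist-descent into Cremona's printed range — binders
`B hB hnf` only.** For a class every globally minimal member `W'` of which has SOME odd prime `p`
with: Kodaira type `I₀*` at `p` and `N(W') ≤ B·p²`; or type `I_ν*` (`ν ≥ 1`) at `p` and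
`N(W') ≤ B·p`; or a displayed twist witness `TwistSemistableWitnessAt W' p` and
`N(W') ≤ B·p` — the class has `|c| = 1` for every optimal `X₀`-datum of every globally
minimal member, whatever the other primes of the conductor are. (Levels are conductors by
modularity, `IsNewformOf.level_eq_conductorNorm_of_exists_isNewformOf`.)
[cite: AgasheRibetStein2006, Thm. 2.6 (p. 619) and appendix Thm. 5.2 (p. 633)]
[cite: Stevens1989, Lemmas (5.2), (5.4)] [cite: SilvermanATAEC1994, IV.11.1 table p. 368]
[cite: EdixhovenManin1991, §1] -/
theorem classAbsManinConstantEqOne_of_forall_exists_kodairaIstar_or_twist_of_level_le_bound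
    (B : ℕ)
    (hB : ∀ (V : WeierstrassCurve ℚ) [V.IsElliptic] [V.IsGloballyMinimal] {M : ℕ} [NeZero M]
      (DV : ModularParametrizationData V M),
      (∀ z ∈ DV.L.lattice, ∃ w ∈ periodLattice DV.f, z = DV.c * w) → M ≤ B →
        |DV.maninConstant| = 1)
    (hnf : exists_isNewformOf)
    (W : WeierstrassCurve ℚ)
    (hcov : ∀ (W' : WeierstrassCurve ℚ) [W'.IsElliptic] [W'.IsGloballyMinimal], IsIsogenous W W' →
      ∃ (p : ℕ) (hp : p.Prime), p ≠ 2 ∧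
        ((W'.kodairaSymbolAt ((primesEquiv (R := ℤ)).symm ⟨p, hp⟩) = .Istar 0 ∧
            W'.conductorNorm ℤ ≤ B * p ^ 2) ∨
         ((∃ n : ℕ, W'.kodairaSymbolAt ((primesEquiv (R := ℤ)).symm ⟨p, hp⟩) = .Istar (n + 1)) ∧
            W'.conductorNorm ℤ ≤ B * p) ∨
         (@TwistSemistableWitnessAt W' p ⟨hp⟩ ∧ W'.conductorNorm ℤ ≤ B * p))) :
    ClassAbsManinConstantEqOne W := by
  intro W' _ _ N' _ D' hiso hopt
  have hN' : N' = W'.conductorNorm ℤ :=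
    IsNewformOf.level_eq_conductorNorm_of_exists_isNewformOf hnf D'.isNewformOf
  subst hN'
  obtain ⟨p, hp, hp2, h⟩ := hcov W' hiso
  rcases h with ⟨hK, hlev⟩ | ⟨⟨n, hK⟩, hlev⟩ | ⟨htw, hlev⟩
  · exact abs_maninConstant_eq_one_of_kodairaSymbolAt_eq_Istar_zero_of_level_le_bound B hB hnf D' hopt hp
      hp2 hK hlev
  · exact abs_maninConstant_eq_one_of_kodairaSymbolAt_eq_Istar_succ_of_level_le_bound B hB hnf D' hopt hp
      hp2 hK hlev
  · haveI : Fact p.Prime := ⟨hp⟩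
    exact abs_maninConstant_eq_one_of_twistSemistableWitnessAt_of_conductorNorm_le_bound B hB hnf W' D'
      hopt htw hlev

/-- **Kodaira-only form with the uniform level bound**: if every globally minimal member `W'` of
the class has an odd prime `p` of Kodaira type `Iₙ*` (some `n ≥ 0`) with `N(W') ≤ B·p`, the
class has `|c| = 1`, modulo `B hB hnf`. [cite: AgasheRibetStein2006, Thm. 2.6]
[cite: SilvermanATAEC1994, IV.11.1 table p. 368] [cite: Stevens1989, Lemmas (5.2), (5.4)] -/
theorem classAbsManinConstantEqOne_of_forall_exists_kodairaIstar_of_level_le_bound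
    (B : ℕ)
    (hB : ∀ (V : WeierstrassCurve ℚ) [V.IsElliptic] [V.IsGloballyMinimal] {M : ℕ} [NeZero M]
      (DV : ModularParametrizationData V M),
      (∀ z ∈ DV.L.lattice, ∃ w ∈ periodLattice DV.f, z = DV.c * w) → M ≤ B →
        |DV.maninConstant| = 1)
    (hnf : exists_isNewformOf)
    (W : WeierstrassCurve ℚ)
    (hcov : ∀ (W' : WeierstrassCurve ℚ) [W'.IsElliptic] [W'.IsGloballyMinimal], IsIsogenous W W' →
      ∃ (p : ℕ) (hp : p.Prime), p ≠ 2 ∧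
        (∃ n : ℕ, W'.kodairaSymbolAt ((primesEquiv (R := ℤ)).symm ⟨p, hp⟩) = .Istar n) ∧
          W'.conductorNorm ℤ ≤ B * p) :
    ClassAbsManinConstantEqOne W := by
  intro W' _ _ N' _ D' hiso hopt
  have hN' : N' = W'.conductorNorm ℤ :=
    IsNewformOf.level_eq_conductorNorm_of_exists_isNewformOf hnf D'.isNewformOf
  subst hN'
  obtain ⟨p, hp, hp2, ⟨n, hK⟩, hlev⟩ := hcov W' hiso
  exact abs_maninConstant_eq_one_of_kodairaSymbolAt_eq_Istar_of_level_le_bound B hB hnf D' hopt hp hp2 hK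
    hlev

/-- The binder form carried by consumers: for such a class, `p ∤ c` for EVERY prime `p` and every
optimal `X₀`-datum of every globally minimal member, modulo `B hB hnf`.
[cite: AgasheRibetStein2006, Thm. 2.6] [cite: Stevens1989, Lemmas (5.2), (5.4)] -/
theorem not_dvd_maninConstant_of_forall_exists_kodairaIstar_or_twist_of_level_le_bound
    (B : ℕ)
    (hB : ∀ (V : WeierstrassCurve ℚ) [V.IsElliptic] [V.IsGloballyMinimal] {M : ℕ} [NeZero M]
      (DV : ModularParametrizationData V M),
      (∀ z ∈ DV.L.lattice, ∃ w ∈ periodLattice DV.f, z = DV.c * w) → M ≤ B →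
        |DV.maninConstant| = 1)
    (hnf : exists_isNewformOf)
    {W : WeierstrassCurve ℚ}
    (hcov : ∀ (W' : WeierstrassCurve ℚ) [W'.IsElliptic] [W'.IsGloballyMinimal], IsIsogenous W W' →
      ∃ (p : ℕ) (hp : p.Prime), p ≠ 2 ∧
        ((W'.kodairaSymbolAt ((primesEquiv (R := ℤ)).symm ⟨p, hp⟩) = .Istar 0 ∧
            W'.conductorNorm ℤ ≤ B * p ^ 2) ∨
         ((∃ n : ℕ, W'.kodairaSymbolAt ((primesEquiv (R := ℤ)).symm ⟨p, hp⟩) = .Istar (n + 1)) ∧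
            W'.conductorNorm ℤ ≤ B * p) ∨
         (@TwistSemistableWitnessAt W' p ⟨hp⟩ ∧ W'.conductorNorm ℤ ≤ B * p)))
    (W' : WeierstrassCurve ℚ) [W'.IsElliptic] [W'.IsGloballyMinimal] {N' : ℕ} [NeZero N']
    (D' : ModularParametrizationData W' N') (hiso : IsIsogenous W W')
    (hopt : ∀ z ∈ D'.L.lattice, ∃ w ∈ periodLattice D'.f, z = D'.c * w)
    (p : ℕ) (hp : p.Prime) : ¬ (p : ℤ) ∣ D'.maninConstant :=
  (classAbsManinConstantEqOne_of_forall_exists_kodairaIstar_or_twist_of_level_le_bound B hB hnf W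
    hcov).not_dvd_maninConstant D' hiso hopt hp

end Literature.NumberTheory.EllipticCurves.ModularForms

end
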